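import Summits.QuantumFields.BalabanUV.Beta.GAN24.GaugeReadChargeMass
import Summits.QuantumFields.BalabanUV.Beta.GAN24.CubicPushFaceCharge

/-!
# `BalabanUV.Beta.GAN24.GaugeReadChargeTransported` — binder row G-an2-4 ∕ (CONV-C), CT-W «WC-TL», (Q-R) «QR-LL», the (S) row of RULING R-gan24p1-g27-1 (the OWNER
# gan24-p1 g27's R14), piece (γ) = the response (gauge-read) letter: **THE TRANSPORTED (γ)-LETTER — THE COARSE FIELD–FIELD ENTRIES OF `G ∘ (γ) ∘ G` PER SLOT HAVE
# `HasSum` EQUAL TO `−N²σ²·` THE EXIT-FACE-WEIGHTED (γ) CHARGE; ITS MASS AND SLOT-DIPOLE AS TREE TERMS; ITS MASS ZERO UNDER BLOCK COVARIANCE** — the (γ) twin of road-P2's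
# `WardResidualRotatedVertexTransported` (INTENT 6 g38), in this lineage's abstract currency (any decaying dressing kernel `K` with Kronecker coarse-leg charges `∓σ`, any
# bi-localised response kernel `A`, any `LocStencil` ∕ `VertexFamily` tables; the literal `K = KInvStep Lc j`, `σ = ((Lc^{j+1})^{d+2})⁻¹` in §2)
# (G-an2-4 formalisation swarm, unit `b2b-balaban-gan24-formalise-leaf-06`, gen 45; INTENT 3, sequel of `GaugeReadChargeProfile` ∕ `GaugeReadChargeMass` (INTENT 1∕2 g45)).

NOT IN PRINT; OUR BOOKKEEPING ([folklore] composition BY NAME: p2 g35's `SandwichReadoutSiteDep.hasSum_sandwich_readout_coDressKBmAt` at `V :=` the (γ) piece (bi-localised by an1's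
`KernelWardResidual.biLoc_gaugeSup`), leaf-02's `CubicPushFaceCharge.sum_sum_face_kron`, this lineage's gen-8 Kronecker leg laws `StepResolventLegCharges.hasSum_KInvStep_inr_inl ∕
_inl_inr` + `MultiplierZeroMass.hasSum_KInvStep_mm_left ∕ _right`, and INTENT 1∕2 `GaugeReadChargeProfile.hasSum_weighted_gaugeSup ∕ hasSum_weightedGaugeCharge_mass ∕
hasSum_slotMoment_weightedGaugeCharge`, `GaugeReadChargeMass.hasSum_weightedGaugeCharge_mass_zero` at the exit-face weight; 0 `def`, 0 cited fact, 0 `def … : Prop`, 0 sorry).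
HONEST FRAMING (cell contract, verbatim): «discharging `BetaPertH` makes Bałaban's UV stability UNCONDITIONAL — a real constructive-QFT result; it is NOT the continuum limit and NOT
the Clay problem.»  HONEST DEPENDENCY (verbatim): «continuum YM on T⁴ ⇐ BetaPertH ∧ nine spine estimates (0/9 proved); BetaPertH ⇐ (D1) ∧ (D4) ∧ CAP+tail; G-an2-4 gates asym,
D1 and NE2/3/4.»

WHAT (`1 ≤ N`, in-block root `r`; `G := coDressKBmAt (toSite r) N K` for a kernel `K` with `Decays K C δK` and KRONECKER COARSE-LEG CHARGES `Σ_{x′} K (N•x′) t (inr α)(inl κ) = −σ·δ_{κα}`,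
`Σ_y K u (N•y) (inl κ′)(inr μ) = σ·δ_{κ′μ}`, zero `mm` leg charges; the (γ) piece `𝒢[A](ĝ_y) = Σ_κ wsum w_κ (S κ) + Σ_ρ cwsum N w′_ρ (M ρ)` of a response kernel `A` bi-localised at `(p,q)`
read against the label-`y` gauge weight, `LocStencil S Cs δ`, `VertexFamily M N CM δ`; the EXIT-FACE WEIGHT `ω_{αβ}(x,z) := 𝟙[x_α % N = N−1 ∧ z_β % N = N−1]` (road-P2's, verbatim)):
* §1 **`hasSum_prod_transported_gaugeSup`**: `HasSum ((x′,z′) ↦ (G ∘ 𝒢[A](ĝ_y) ∘ G)(N•x′, N•z′)_{(inr α, inr β)}) (−N²·σ²·Q^{face}_{αβ})`, `Q^{face}_{αβ}` = INTENT 1's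
  `hasSum_weighted_gaugeSup` value at `ω = ω_{αβ}`, channel `(inl α, inl β)` — THE TRANSPORTED (γ)-CHARGE PER SLOT IS `−N²σ²·` A FACE-WEIGHTED (γ) ω-CHARGE.
* §2 `hasSum_prod_transported_gaugeSup_KInvStep`: the literal dressing kernel `K = KInvStep Lc j`, `σ = ((Lc^{j+1})^{d+2})⁻¹` (the gen-8 leg laws BY NAME).
* §3 for the slot family `A ν y′` (`VertexFamily A N CA δ`): **`hasSum_transported_gaugeCharge_mass`** (closed form), **`hasSum_transported_gaugeCharge_slotMoment`** (the (γ) number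
  of R12's (S) ∕ E15's `π_λ`, DISPLAYED as a tree term — E19: exactly opposite to (α)'s; the cancellation is the (S)∕(INV) row, NOT here), and
  **`hasSum_transported_gaugeCharge_mass_zero`**: under (COV) + (PER at `ω_{αβ}`) the transported (γ)-charge has ZERO MASS.
Asserts NO value of Bałaban's tables, NO cancellation, NOTHING of (INV); (COV)∕(PER) DISPLAYED; 0 estimate; discharges NOTHING of (S) beyond the (γ) summand of (M0), nor of
(Q-R) ∕ (LT) ∕ (Q-L) ∕ (C) ∕ «T2Shape» ∕ «T2Drift» ∕ (hW, hWall); NEVER «G-an2-4 closed» as (CONV-C); NOT D1, NOT BetaPertH, NOT continuum, NOT Clay.  2026-08-22; no existing file touched.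
-/

noncomputable section

open Finset
open scoped BigOperators
open Literature.MathematicalPhysics.QuantumFieldTheory
open Literature.MathematicalPhysics.QuantumFieldTheory.Balaban1983to89
open Literature.MathematicalPhysics.QuantumFieldTheory.Balaban1983to89.Beta
open B12Sec2to5 (l1)
open ExpKernelCalculus (Site MKer BiLoc Decays VertexFamily comp)
open AffineAveraging (box toSite)
open OneStepResolventKernel (Fib wsum LocStencil)
open OneStepKernelFamily (KInvStep decays_KInvStep)
open InterLevelTransport (cwsum)
open Summit.QuantumFields.BalabanUV.Beta.AxialDressingRooted (coDressKBmAt)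
open Summit.QuantumFields.BalabanUV.Beta.KernelWardRelative (gaugeWt)
open Summit.QuantumFields.BalabanUV.Beta.KernelWardResidual (abs_gaugeWt_le_one biLoc_gaugeSup)
open Summit.QuantumFields.BalabanUV.Beta.GAN24.SandwichReadoutSiteDep (hasSum_sandwich_readout_coDressKBmAt)
open Summit.QuantumFields.BalabanUV.Beta.GAN24.StepResolventLegCharges (hasSum_KInvStep_inr_inl hasSum_KInvStep_inl_inr)
open Summit.QuantumFields.BalabanUV.Beta.GAN24.MultiplierZeroMass (hasSum_KInvStep_mm_left hasSum_KInvStep_mm_right)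
open Summit.QuantumFields.BalabanUV.Beta.GAN24.CubicPushFaceCharge (sum_sum_face_kron)
open Summit.QuantumFields.BalabanUV.Beta.GAN24.GaugeReadChargeProfile (hasSum_weighted_gaugeSup hasSum_weightedGaugeCharge_mass hasSum_slotMoment_weightedGaugeCharge)
open Summit.QuantumFields.BalabanUV.Beta.GAN24.GaugeReadChargeMass (hasSum_weightedGaugeCharge_mass_zero)

namespace Summit.QuantumFields.BalabanUV.Beta.GAN24.GaugeReadChargeTransported

variable {d : ℕ}

/-- [folklore] The exit-face weight is bounded by `1`. -/
theorem abs_faceWeight_le_one (N : ℕ) (α β : Fin (d + 1)) (xz : Site (d + 1) × Site (d + 1)) :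
    |(if xz.1 α % (N : ℤ) = (N : ℤ) - 1 ∧ xz.2 β % (N : ℤ) = (N : ℤ) - 1 then (1 : ℝ) else 0)| ≤ 1 := by
  split_ifs <;> simp

/-! ## §1 The transported (γ)-charge per slot is `−N²σ²·` a face-weighted (γ) ω-charge -/

/-- NOT IN PRINT; OUR BOOKKEEPING.  **THE TRANSPORTED (γ)-LETTER PER SLOT.**  `1 ≤ N`, in-block root `r`, dressing kernel `K` (`Decays K C δK`, `δK > 0`) with KRONECKER coarse-leg
charges (`Σ_{x′} K (N•x′) t (inr α)(inl κ) = −σ·δ_{κα}`, `Σ_y K u (N•y) (inl κ′)(inr μ) = σ·δ_{κ′μ}`, zero `mm` leg charges), `G := coDressKBmAt (toSite r) N K`; a response kernel `A`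
bi-localised at `(p, q)` (rate `δ > 0`), `LocStencil S Cs δ`, `VertexFamily M N CM δ`, label `y`, coarse channel `(α, β)`.  Then the coarse field–field entries of
`G ∘ 𝒢[A](ĝ_y) ∘ G` have `HasSum` over `(x′, z′)` equal to `−N²·σ²·Q^{face}_{αβ}`, where `Q^{face}_{αβ}` is the (γ) ω-charge of `GaugeReadChargeProfile.hasSum_weighted_gaugeSup` at the
EXIT-FACE WEIGHT `ω_{αβ}(x,z) = 𝟙[x_α % N = N−1 ∧ z_β % N = N−1]`, channel `(inl α, inl β)` (p2 g35's sandwich read-out at `V := 𝒢[A](ĝ_y)`, bi-localised by an1's `biLoc_gaugeSup`;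
leaf-02's Kronecker fold; INTENT 1).  The (γ) twin of road-P2's `hasSum_prod_transported_rotatedVertex_comb`. -/
theorem hasSum_prod_transported_gaugeSup {N : ℕ} [NeZero N] (hN : 1 ≤ N) {r : Fin (d + 1) → ℕ} (hr : r ∈ box (d + 1) N)
    {K : MKer (d + 1) (Fib d)} {C δK : ℝ} (hK : Decays K C δK) (hδK : 0 < δK) {σ : ℝ}
    (hL : ∀ (t : Site (d + 1)) (α κ : Fin (d + 1)), HasSum (fun x' : Site (d + 1) => K ((N : ℤ) • x') t (Sum.inr α) (Sum.inl κ)) (-(if κ = α then σ else 0)))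
    (hL0 : ∀ (t : Site (d + 1)) (α m : Fin (d + 1)), HasSum (fun x' : Site (d + 1) => K ((N : ℤ) • x') t (Sum.inr α) (Sum.inr m)) 0)
    (hR : ∀ (u : Site (d + 1)) (κ' μ : Fin (d + 1)), HasSum (fun z' : Site (d + 1) => K u ((N : ℤ) • z') (Sum.inl κ') (Sum.inr μ)) (if κ' = μ then σ else 0))
    (hR0 : ∀ (u : Site (d + 1)) (m μ : Fin (d + 1)), HasSum (fun z' : Site (d + 1) => K u ((N : ℤ) • z') (Sum.inr m) (Sum.inr μ)) 0)
    {A : MKer (d + 1) (Fib d)} {p q : Site (d + 1)} {CA δ : ℝ} (hA : BiLoc A p q CA δ) (hδ : 0 < δ)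
    {S : Fin (d + 1) → Site (d + 1) → MKer (d + 1) (Fib d)} {Cs : ℝ} (hS : LocStencil S Cs δ)
    {M : Fin (d + 1) → Site (d + 1) → MKer (d + 1) (Fib d)} {CM : ℝ} (hM : VertexFamily M N CM δ) (y : Site (d + 1)) (α β : Fin (d + 1)) :
    HasSum (fun xz : Site (d + 1) × Site (d + 1) =>
        comp (comp (coDressKBmAt (toSite r) N K)
          (∑ κ, wsum (fun u => ∑' x₂, ∑ κ₂, A u x₂ (Sum.inl κ) (Sum.inl κ₂) * gaugeWt N y κ₂ x₂) (S κ)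
            + ∑ ρ, cwsum N (fun w => ∑' x₂, ∑ κ₂, A ((N : ℤ) • w) x₂ (Sum.inr ρ) (Sum.inl κ₂) * gaugeWt N y κ₂ x₂) (M ρ)))
          (coDressKBmAt (toSite r) N K) ((N : ℤ) • xz.1) ((N : ℤ) • xz.2) (Sum.inr α) (Sum.inr β))
      (-((N : ℝ) ^ 2 * σ ^ 2 *
        (∑ κ, ∑' u, (∑' x₂, ∑ κ₂, A u x₂ (Sum.inl κ) (Sum.inl κ₂) * gaugeWt N y κ₂ x₂) *
              ∑' xz : Site (d + 1) × Site (d + 1),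
                (if xz.1 α % (N : ℤ) = (N : ℤ) - 1 ∧ xz.2 β % (N : ℤ) = (N : ℤ) - 1 then (1 : ℝ) else 0) * S κ u xz.1 xz.2 (Sum.inl α) (Sum.inl β)
          + ∑ ρ, ∑' w, (∑' x₂, ∑ κ₂, A ((N : ℤ) • w) x₂ (Sum.inr ρ) (Sum.inl κ₂) * gaugeWt N y κ₂ x₂) *
              ∑' xz : Site (d + 1) × Site (d + 1),
                (if xz.1 α % (N : ℤ) = (N : ℤ) - 1 ∧ xz.2 β % (N : ℤ) = (N : ℤ) - 1 then (1 : ℝ) else 0) * M ρ w xz.1 xz.2 (Sum.inl α) (Sum.inl β)))) := by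
  classical
  have hV := biLoc_gaugeSup hA hδ hS hM y
  -- the sandwich read-out at `V := 𝒢[A](ĝ_y)` with the Kronecker leg charges
  have h := hasSum_sandwich_readout_coDressKBmAt hN hr hK hδK hV (half_pos hδ) α β
    (cL := fun α κ => -(if κ = α then σ else 0)) (cR := fun κ' μ => if κ' = μ then σ else 0) hL hL0 hR hR0
  simp only [sum_sum_face_kron] at h
  rw [tsum_neg, tsum_mul_left] at h
  -- the face-restricted pair sum of the (γ) piece is its ω-charge at the exit-face weight: INTENT 1 §2
  have hw := hasSum_weighted_gaugeSup hA hδ (fun κ x => abs_gaugeWt_le_one N y κ x) hN hS hM (Sum.inl α) (Sum.inl β) (abs_faceWeight_le_one N α β)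
  have e : (∑' yw : Site (d + 1) × Site (d + 1),
      (if yw.1 α % (N : ℤ) = (N : ℤ) - 1 ∧ yw.2 β % (N : ℤ) = (N : ℤ) - 1 then
        (∑ κ, wsum (fun u => ∑' x₂, ∑ κ₂, A u x₂ (Sum.inl κ) (Sum.inl κ₂) * gaugeWt N y κ₂ x₂) (S κ)
          + ∑ ρ, cwsum N (fun w => ∑' x₂, ∑ κ₂, A ((N : ℤ) • w) x₂ (Sum.inr ρ) (Sum.inl κ₂) * gaugeWt N y κ₂ x₂) (M ρ)) yw.1 yw.2 (Sum.inl α) (Sum.inl β)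
        else 0)) = _ := (hw.congr_fun fun yw => by rw [boole_mul]).tsum_eq
  rw [e] at h
  exact h

/-! ## §2 The literal dressing kernel `KInvStep Lc j` -/

/-- NOT IN PRINT; OUR BOOKKEEPING.  **§1 AT THE LITERAL DRESSING KERNEL** `K = KInvStep Lc j` (every level `j`): `σ = ((Lc^{j+1})^{d+2})⁻¹` by this lineage's gen-8 Kronecker leg laws
`StepResolventLegCharges.hasSum_KInvStep_inr_inl ∕ _inl_inr`, `MultiplierZeroMass.hasSum_KInvStep_mm_left ∕ _right`, and `decays_KInvStep` BY NAME. -/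
theorem hasSum_prod_transported_gaugeSup_KInvStep {Lc : ℕ} [NeZero Lc] (hLc : 1 ≤ Lc) {r : Fin (d + 1) → ℕ} (hr : r ∈ box (d + 1) Lc) (j : ℕ)
    {A : MKer (d + 1) (Fib d)} {p q : Site (d + 1)} {CA δ : ℝ} (hA : BiLoc A p q CA δ) (hδ : 0 < δ)
    {S : Fin (d + 1) → Site (d + 1) → MKer (d + 1) (Fib d)} {Cs : ℝ} (hS : LocStencil S Cs δ)
    {M : Fin (d + 1) → Site (d + 1) → MKer (d + 1) (Fib d)} {CM : ℝ} (hM : VertexFamily M Lc CM δ) (y : Site (d + 1)) (α β : Fin (d + 1)) :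
    HasSum (fun xz : Site (d + 1) × Site (d + 1) =>
        comp (comp (coDressKBmAt (toSite r) Lc (KInvStep (d := d) Lc j))
          (∑ κ, wsum (fun u => ∑' x₂, ∑ κ₂, A u x₂ (Sum.inl κ) (Sum.inl κ₂) * gaugeWt Lc y κ₂ x₂) (S κ)
            + ∑ ρ, cwsum Lc (fun w => ∑' x₂, ∑ κ₂, A ((Lc : ℤ) • w) x₂ (Sum.inr ρ) (Sum.inl κ₂) * gaugeWt Lc y κ₂ x₂) (M ρ)))
          (coDressKBmAt (toSite r) Lc (KInvStep (d := d) Lc j)) ((Lc : ℤ) • xz.1) ((Lc : ℤ) • xz.2) (Sum.inr α) (Sum.inr β))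
      (-((Lc : ℝ) ^ 2 * (((((Lc ^ (j + 1) : ℕ) : ℝ)) ^ (d + 1 + 1))⁻¹) ^ 2 *
        (∑ κ, ∑' u, (∑' x₂, ∑ κ₂, A u x₂ (Sum.inl κ) (Sum.inl κ₂) * gaugeWt Lc y κ₂ x₂) *
              ∑' xz : Site (d + 1) × Site (d + 1),
                (if xz.1 α % (Lc : ℤ) = (Lc : ℤ) - 1 ∧ xz.2 β % (Lc : ℤ) = (Lc : ℤ) - 1 then (1 : ℝ) else 0) * S κ u xz.1 xz.2 (Sum.inl α) (Sum.inl β)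
          + ∑ ρ, ∑' w, (∑' x₂, ∑ κ₂, A ((Lc : ℤ) • w) x₂ (Sum.inr ρ) (Sum.inl κ₂) * gaugeWt Lc y κ₂ x₂) *
              ∑' xz : Site (d + 1) × Site (d + 1),
                (if xz.1 α % (Lc : ℤ) = (Lc : ℤ) - 1 ∧ xz.2 β % (Lc : ℤ) = (Lc : ℤ) - 1 then (1 : ℝ) else 0) * M ρ w xz.1 xz.2 (Sum.inl α) (Sum.inl β)))) := by
  obtain ⟨δK, C, hδK, -, hK⟩ := decays_KInvStep (d := d) (Lc := Lc) j
  exact hasSum_prod_transported_gaugeSup hLc hr hK hδK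
    (fun t α κ => hasSum_KInvStep_inr_inl j α κ t) (fun t α m => hasSum_KInvStep_mm_left j α m t)
    (fun u κ' μ => hasSum_KInvStep_inl_inr j κ' μ u) (fun u m μ => hasSum_KInvStep_mm_right j m μ u) hA hδ hS hM y α β

/-! ## §3 The transported (γ)-charge profile over the slots: mass, slot-dipole, and mass zero under block covariance -/

section Slots

variable {N : ℕ} {A : Fin (d + 1) → Site (d + 1) → MKer (d + 1) (Fib d)} {CA δ : ℝ}
  {S : Fin (d + 1) → Site (d + 1) → MKer (d + 1) (Fib d)} {Cs : ℝ} {M : Fin (d + 1) → Site (d + 1) → MKer (d + 1) (Fib d)} {CM : ℝ}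

/-- NOT IN PRINT; OUR BOOKKEEPING.  **THE MASS OF THE TRANSPORTED (γ)-CHARGE PROFILE, CLOSED FORM**: for the slot family `A ν y′` (`VertexFamily A N CA δ`) the per-slot value of §1∕§2,
`−c·Q^{face}_{αβ}(y′)` (`c` any scalar, `N²σ²` in the literal), summed over the slots `y′`: `HasSum` with value `−c·`(INTENT 1 §4's closed form at `ω_{αβ}`). -/
theorem hasSum_transported_gaugeCharge_mass (hN : 1 ≤ N) (hA : VertexFamily A N CA δ) (hδ : 0 < δ) (hS : LocStencil S Cs δ) (hM : VertexFamily M N CM δ)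
    (y : Site (d + 1)) (ν α β : Fin (d + 1)) (c : ℝ) :
    HasSum (fun y' : Site (d + 1) => -(c *
        (∑ κ, ∑' u, (∑' x₂, ∑ κ₂, A ν y' u x₂ (Sum.inl κ) (Sum.inl κ₂) * gaugeWt N y κ₂ x₂) *
              ∑' xz : Site (d + 1) × Site (d + 1),
                (if xz.1 α % (N : ℤ) = (N : ℤ) - 1 ∧ xz.2 β % (N : ℤ) = (N : ℤ) - 1 then (1 : ℝ) else 0) * S κ u xz.1 xz.2 (Sum.inl α) (Sum.inl β)
          + ∑ ρ, ∑' w, (∑' x₂, ∑ κ₂, A ν y' ((N : ℤ) • w) x₂ (Sum.inr ρ) (Sum.inl κ₂) * gaugeWt N y κ₂ x₂) *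
              ∑' xz : Site (d + 1) × Site (d + 1),
                (if xz.1 α % (N : ℤ) = (N : ℤ) - 1 ∧ xz.2 β % (N : ℤ) = (N : ℤ) - 1 then (1 : ℝ) else 0) * M ρ w xz.1 xz.2 (Sum.inl α) (Sum.inl β))))
      (-(c *
        (∑ κ, ∑' u, (∑' y' : Site (d + 1), ∑' x₂, ∑ κ₂, A ν y' u x₂ (Sum.inl κ) (Sum.inl κ₂) * gaugeWt N y κ₂ x₂) *
              ∑' xz : Site (d + 1) × Site (d + 1),
                (if xz.1 α % (N : ℤ) = (N : ℤ) - 1 ∧ xz.2 β % (N : ℤ) = (N : ℤ) - 1 then (1 : ℝ) else 0) * S κ u xz.1 xz.2 (Sum.inl α) (Sum.inl β)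
          + ∑ ρ, ∑' w, (∑' y' : Site (d + 1), ∑' x₂, ∑ κ₂, A ν y' ((N : ℤ) • w) x₂ (Sum.inr ρ) (Sum.inl κ₂) * gaugeWt N y κ₂ x₂) *
              ∑' xz : Site (d + 1) × Site (d + 1),
                (if xz.1 α % (N : ℤ) = (N : ℤ) - 1 ∧ xz.2 β % (N : ℤ) = (N : ℤ) - 1 then (1 : ℝ) else 0) * M ρ w xz.1 xz.2 (Sum.inl α) (Sum.inl β)))) :=
  ((hasSum_weightedGaugeCharge_mass hN hA hδ hS hM y ν (Sum.inl α) (Sum.inl β) (abs_faceWeight_le_one N α β)).mul_left c).neg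

/-- NOT IN PRINT; OUR BOOKKEEPING.  **THE SLOT-DIPOLE OF THE TRANSPORTED (γ)-CHARGE PROFILE, CLOSED FORM** — the (γ) NUMBER of R12's (S) ∕ E15∕E19's `π_λ(γ)` (exactly opposite to
(α)'s on the engine), DISPLAYED as a tree term: `Σ'_{y′} (y′−y)_λ·(−c·Q^{face}_{αβ}(y′)) = −c·`(INTENT 4∕INTENT 1's closed slot-moment at `ω_{αβ}`).  Its cancellation against
road-P2's `hasSum_transported_slotMoment_comb` is the (S)∕(INV) row — NOT claimed here. -/
theorem hasSum_transported_gaugeCharge_slotMoment (hN : 1 ≤ N) (hA : VertexFamily A N CA δ) (hδ : 0 < δ) (hS : LocStencil S Cs δ) (hM : VertexFamily M N CM δ)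
    (y : Site (d + 1)) (ν lam α β : Fin (d + 1)) (c : ℝ) :
    HasSum (fun y' : Site (d + 1) => (((y' - y) lam : ℤ) : ℝ) * -(c *
        (∑ κ, ∑' u, (∑' x₂, ∑ κ₂, A ν y' u x₂ (Sum.inl κ) (Sum.inl κ₂) * gaugeWt N y κ₂ x₂) *
              ∑' xz : Site (d + 1) × Site (d + 1),
                (if xz.1 α % (N : ℤ) = (N : ℤ) - 1 ∧ xz.2 β % (N : ℤ) = (N : ℤ) - 1 then (1 : ℝ) else 0) * S κ u xz.1 xz.2 (Sum.inl α) (Sum.inl β)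
          + ∑ ρ, ∑' w, (∑' x₂, ∑ κ₂, A ν y' ((N : ℤ) • w) x₂ (Sum.inr ρ) (Sum.inl κ₂) * gaugeWt N y κ₂ x₂) *
              ∑' xz : Site (d + 1) × Site (d + 1),
                (if xz.1 α % (N : ℤ) = (N : ℤ) - 1 ∧ xz.2 β % (N : ℤ) = (N : ℤ) - 1 then (1 : ℝ) else 0) * M ρ w xz.1 xz.2 (Sum.inl α) (Sum.inl β))))
      (-(c *
        (∑ κ, ∑' u, (∑' y' : Site (d + 1), (((y' - y) lam : ℤ) : ℝ) * ∑' x₂, ∑ κ₂, A ν y' u x₂ (Sum.inl κ) (Sum.inl κ₂) * gaugeWt N y κ₂ x₂) *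
              ∑' xz : Site (d + 1) × Site (d + 1),
                (if xz.1 α % (N : ℤ) = (N : ℤ) - 1 ∧ xz.2 β % (N : ℤ) = (N : ℤ) - 1 then (1 : ℝ) else 0) * S κ u xz.1 xz.2 (Sum.inl α) (Sum.inl β)
          + ∑ ρ, ∑' w, (∑' y' : Site (d + 1), (((y' - y) lam : ℤ) : ℝ) *
                ∑' x₂, ∑ κ₂, A ν y' ((N : ℤ) • w) x₂ (Sum.inr ρ) (Sum.inl κ₂) * gaugeWt N y κ₂ x₂) *
              ∑' xz : Site (d + 1) × Site (d + 1),
                (if xz.1 α % (N : ℤ) = (N : ℤ) - 1 ∧ xz.2 β % (N : ℤ) = (N : ℤ) - 1 then (1 : ℝ) else 0) * M ρ w xz.1 xz.2 (Sum.inl α) (Sum.inl β)))) := by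
  have h := ((hasSum_slotMoment_weightedGaugeCharge hN hA hδ hS hM y ν lam (Sum.inl α) (Sum.inl β) (abs_faceWeight_le_one N α β)).mul_left c).neg
  refine h.congr_fun fun y' => ?_
  ring

/-- NOT IN PRINT; OUR BOOKKEEPING.  **THE TRANSPORTED (γ)-CHARGE HAS ZERO MASS UNDER BLOCK COVARIANCE**: with (COV) `A ν (y′+s) (u + N•s) (x + N•s) r c = A ν y′ u x r c` and (PER) the
block-periodicity of the exit-face-weighted table charges (for the literal tables: road-P2's `faceWeight_periodic` + `weightedCharge_SpureRecAt_block ∕ _M1At_const`), the per-slot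
transported values `−c·Q^{face}_{αβ}(y′)` sum to `0` over the slots — the (γ) twin of road-P2's `hasSum_transported_totalCharge_comb` (INTENT 2's (M0)_γ at `ω_{αβ}`, times `−c`). -/
theorem hasSum_transported_gaugeCharge_mass_zero (hN : 1 ≤ N) (hA : VertexFamily A N CA δ) (hδ : 0 < δ) (hS : LocStencil S Cs δ) (hM : VertexFamily M N CM δ)
    (y : Site (d + 1)) (ν α β : Fin (d + 1)) (c : ℝ)
    (hAcov : ∀ (y' s u x : Site (d + 1)) (r c : Fib d), A ν (y' + s) (u + (N : ℤ) • s) (x + (N : ℤ) • s) r c = A ν y' u x r c)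
    (hZS : ∀ (κ : Fin (d + 1)) (u s : Site (d + 1)),
      ∑' xz : Site (d + 1) × Site (d + 1),
          (if xz.1 α % (N : ℤ) = (N : ℤ) - 1 ∧ xz.2 β % (N : ℤ) = (N : ℤ) - 1 then (1 : ℝ) else 0) * S κ (u + (N : ℤ) • s) xz.1 xz.2 (Sum.inl α) (Sum.inl β)
        = ∑' xz : Site (d + 1) × Site (d + 1),
          (if xz.1 α % (N : ℤ) = (N : ℤ) - 1 ∧ xz.2 β % (N : ℤ) = (N : ℤ) - 1 then (1 : ℝ) else 0) * S κ u xz.1 xz.2 (Sum.inl α) (Sum.inl β))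
    (hZM : ∀ (ρ : Fin (d + 1)) (w s : Site (d + 1)),
      ∑' xz : Site (d + 1) × Site (d + 1),
          (if xz.1 α % (N : ℤ) = (N : ℤ) - 1 ∧ xz.2 β % (N : ℤ) = (N : ℤ) - 1 then (1 : ℝ) else 0) * M ρ (w + s) xz.1 xz.2 (Sum.inl α) (Sum.inl β)
        = ∑' xz : Site (d + 1) × Site (d + 1),
          (if xz.1 α % (N : ℤ) = (N : ℤ) - 1 ∧ xz.2 β % (N : ℤ) = (N : ℤ) - 1 then (1 : ℝ) else 0) * M ρ w xz.1 xz.2 (Sum.inl α) (Sum.inl β)) :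
    HasSum (fun y' : Site (d + 1) => -(c *
        (∑ κ, ∑' u, (∑' x₂, ∑ κ₂, A ν y' u x₂ (Sum.inl κ) (Sum.inl κ₂) * gaugeWt N y κ₂ x₂) *
              ∑' xz : Site (d + 1) × Site (d + 1),
                (if xz.1 α % (N : ℤ) = (N : ℤ) - 1 ∧ xz.2 β % (N : ℤ) = (N : ℤ) - 1 then (1 : ℝ) else 0) * S κ u xz.1 xz.2 (Sum.inl α) (Sum.inl β)
          + ∑ ρ, ∑' w, (∑' x₂, ∑ κ₂, A ν y' ((N : ℤ) • w) x₂ (Sum.inr ρ) (Sum.inl κ₂) * gaugeWt N y κ₂ x₂) *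
              ∑' xz : Site (d + 1) × Site (d + 1),
                (if xz.1 α % (N : ℤ) = (N : ℤ) - 1 ∧ xz.2 β % (N : ℤ) = (N : ℤ) - 1 then (1 : ℝ) else 0) * M ρ w xz.1 xz.2 (Sum.inl α) (Sum.inl β)))) 0 := by
  have h := ((hasSum_weightedGaugeCharge_mass_zero hN hA hδ hS hM y ν (Sum.inl α) (Sum.inl β) (abs_faceWeight_le_one N α β) hAcov hZS hZM).mul_left c).neg
  rw [mul_zero, neg_zero] at h
  exact h

end Slots

end Summit.QuantumFields.BalabanUV.Beta.GAN24.GaugeReadChargeTransported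

end
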